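import Literature.NumberTheory.ComplexMultiplication.EllipticUnits.CMLatticeOverHilbertClassNumberOne
import Summits.BirchSwinnertonDyer.BirchSwinnertonDyer.Theorems.GoldfeldAllTwistsTwoConverseTwinAdditiveRootNumber
import HarnessLib

/-!
# The MODEL LATTICE of the `cm7` integer model `W = [1,−1,0,−2,−1]` (`49a1`): `Λ_W = Ω_E·ι(𝒪_K)` with `g₂ = c₄(W)/12`, `g₃ = c₆(W)/216`,
# and its presentation `Ω_𝔪·ι(𝔪)` at every principal level `𝔪 = (μ)` (de Shalit II §4.2 (6) «we assume `L = Ω𝔣`»)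

Cell `bsd-print-cf2`, width seat `bsd-line-cf2-p1-w8` g13 (piece V1-model of the `j = 0` seam values [I2]); `--supports` the crux
stmt-BirchSwinnertonDyer-20368 (helper, Theses-free).  THEOREMS ONLY; no `def`, no named fact, no `sorry`.

The bridge `KatzMeasureJZeroSeam.exists_tateUnit_forall_relColemanSeries_eq_subst_subst_of_lane` (B10f-e) and its predecessors take the model
lattice as the binders `(L : PeriodPair) {Ω} (hL : ∀ z, z ∈ L.lattice ↔ ∃ a ∈ 𝔪, z = Ω * ι a) (hΩ : Ω ≠ 0) (h₂ : L.g₂ = (W.baseChange ℂ).c₄ / 12)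
(h₃ : L.g₃ = (W.baseChange ℂ).c₆ / 216)`.  THIS file supplies them on the frame `d_K = −7` from the PROVED Coates–Wiles period leaf
`exists_isCMPeriod_of_j_mem_maximalCMJInvariants_holds` (uniformisation + singular moduli), applied to `W ⊗ ℚ` (`j = −3375 = j(𝒪_{ℚ(√−7)})`,
`Δ = −343`), and `exists_forall_mem_cmRing_discr_iff` (`ℤ[ω_{−7}] = ι(𝒪_K)`):

* `cm7Int_c₆`, `cm7Rat_j`, `cm7Rat_isElliptic` — the invariants `1323, −3375` (`c₄ = 105`, `Δ = −343` reused: `GoldfeldGoodTwists.int49a1_c₄`, `int49a1_Δ`);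
* ★ `exists_modelLattice_cm7` — **`∃ Ω_E ≠ 0, ∃ L, Λ_L = Ω_E·ι(𝒪_K) ∧ L.g₂ = c₄(W ⊗ ℂ)/12 ∧ L.g₃ = c₆(W ⊗ ℂ)/216`** (+ `IsCMLattice ι Λ_L`);
* ★ `modelLattice_spec_of_span_singleton_eq` — at a principal level `𝔪 = (μ)`: **`Λ_L = (Ω_E/ι μ)·ι(𝔪)`**, the bridge's `hL` with `Ω := Ω_E/ι(μ)`.

No summit statement is proved; BSD is not proved by any of this.
References: [deShalit1987] II §4.2 (6) (p. 57), II §1.1 (p. 36); [CoatesWiles1977] §1 (p. 225); [SilvermanAEC2009] VI.5.1, III.1.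
-/

-- the summit namespace `Summit.BirchSwinnertonDyer.BirchSwinnertonDyer` repeats the problem name by design (D-0017)
set_option linter.dupNamespace false
set_option autoImplicit false

noncomputable section

open NumberField PeriodPair
open Literature.NumberTheory.EllipticCurves Literature.NumberTheory.ComplexMultiplication.EllipticUnits

namespace Summit.BirchSwinnertonDyer.BirchSwinnertonDyer.Theorems.PrintCf2.KatzMeasureJZeroSeam

/-! ## §1 The invariants of `W = [1,−1,0,−2,−1]` -/

/-- `c₆(W) = 1323`. [cite: SilvermanAEC2009, III.1] -/
theorem cm7Int_c₆ : (⟨1, -1, 0, -2, -1⟩ : WeierstrassCurve ℤ).c₆ = 1323 := by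
  simp only [WeierstrassCurve.c₆, WeierstrassCurve.b₂, WeierstrassCurve.b₄, WeierstrassCurve.b₆]; norm_num

/-- `W ⊗ ℚ` is an elliptic curve (`Δ = −343 ≠ 0`). [cite: SilvermanAEC2009, III.1] -/
theorem cm7Rat_isElliptic : ((⟨1, -1, 0, -2, -1⟩ : WeierstrassCurve ℤ).map (Int.castRingHom ℚ)).IsElliptic := by
  refine ⟨?_⟩
  rw [WeierstrassCurve.map_Δ, GoldfeldGoodTwists.int49a1_Δ, isUnit_iff_ne_zero]
  norm_num

/-- `j(W ⊗ ℚ) = −3375 = j(𝒪_{ℚ(√−7)})`. [cite: SilvermanAEC2009, III.1, App. A §3] -/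
theorem cm7Rat_j : letI := cm7Rat_isElliptic; ((⟨1, -1, 0, -2, -1⟩ : WeierstrassCurve ℤ).map (Int.castRingHom ℚ)).j = -3375 := by
  letI := cm7Rat_isElliptic
  rw [WeierstrassCurve.j, Units.val_inv_eq_inv_val, WeierstrassCurve.coe_Δ', WeierstrassCurve.map_c₄, WeierstrassCurve.map_Δ, GoldfeldGoodTwists.int49a1_c₄,
    GoldfeldGoodTwists.int49a1_Δ]
  norm_num

/-! ## §2 The model lattice `Λ_W = Ω_E·ι(𝒪_K)` -/

variable {K : Type} [Field K] [NumberField K]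

/-- ★ **THE MODEL LATTICE**: for `K` imaginary quadratic with `d_K = −7` and any `ι : K → ℂ` there are `Ω_E ≠ 0` and a period pair `L` with
`Λ_L = Ω_E·ι(𝒪_K)` (so `Λ_L` has `𝒪_K`-multiplication), `g₂(L) = c₄(W ⊗ ℂ)/12`, `g₃(L) = c₆(W ⊗ ℂ)/216` for `W = [1,−1,0,−2,−1]` — the period lattice
of the Néron differential of `49a1`, from the proved Coates–Wiles period leaf at `j = −3375`. [cite: CoatesWiles1977, §1 (p. 225)]
[cite: deShalit1987, II §1.1 (p. 36), II §4.2 (6) (p. 57)] [cite: SilvermanAEC2009, VI.5.1] -/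
theorem exists_modelLattice_cm7 (hK : IsImaginaryQuadratic K) (hd : NumberField.discr K = -7) (ι : K →+* ℂ) :
    ∃ (Ω : ℂ) (L : PeriodPair), Ω ≠ 0 ∧ (∀ z : ℂ, z ∈ L.lattice ↔ ∃ a : 𝓞 K, z = Ω * ι (a : K)) ∧ IsCMLattice ι L.lattice ∧
      L.g₂ = (((⟨1, -1, 0, -2, -1⟩ : WeierstrassCurve ℤ)).baseChange ℂ).c₄ / 12 ∧
      L.g₃ = (((⟨1, -1, 0, -2, -1⟩ : WeierstrassCurve ℤ)).baseChange ℂ).c₆ / 216 := by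
  classical
  letI := cm7Rat_isElliptic
  set W : WeierstrassCurve ℚ := ((⟨1, -1, 0, -2, -1⟩ : WeierstrassCurve ℤ).map (Int.castRingHom ℚ)) with hW
  have hWj : W.j = -3375 := cm7Rat_j
  have hj : W.j ∈ maximalCMJInvariants := by rw [hWj]; simp [maximalCMJInvariants]
  obtain ⟨Ω₀, L, hL, hLΩ⟩ := exists_isCMPeriod_of_j_mem_maximalCMJInvariants_holds W hj
  have hjd : cmDiscr W.j = NumberField.discr K := by rw [hWj, hd]; norm_num [cmDiscr]
  rw [hjd] at hLΩ
  have hring := exists_forall_mem_cmRing_discr_iff hK (by rw [hd]; decide) ι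
  have hmem : ∀ z : ℂ, z ∈ L.lattice ↔ ∃ a : 𝓞 K, z = Ω₀ * ι (a : K) := by
    intro z
    rw [← SetLike.mem_coe, hLΩ, Set.mem_image]
    constructor
    · rintro ⟨r, hr, rfl⟩
      obtain ⟨a, ha⟩ := (hring r).mp hr
      exact ⟨a, by rw [ha]⟩
    · rintro ⟨a, rfl⟩
      exact ⟨ι (a : K), (hring _).mpr ⟨a, rfl⟩, rfl⟩
  have hΩ₀ : Ω₀ ≠ 0 := by
    intro h0
    obtain ⟨a, ha⟩ := (hmem L.ω₁).mp L.ω₁_mem_lattice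
    rw [h0, zero_mul] at ha
    exact (LinearIndependent.ne_zero 0 L.indep) (by simpa using ha)
  have hCM : IsCMLattice ι L.lattice := by
    intro a x hx
    obtain ⟨c, rfl⟩ := (hmem x).mp hx
    exact (hmem _).mpr ⟨a * c, by push_cast; rw [map_mul]; ring⟩
  -- `c₄(W ⊗_ℚ ℂ) = c₄(W_ℤ ⊗ ℂ)`, `c₆` likewise
  have h4 : (W.baseChange ℂ).c₄ = (((⟨1, -1, 0, -2, -1⟩ : WeierstrassCurve ℤ)).baseChange ℂ).c₄ := by
    simp only [hW, WeierstrassCurve.baseChange, WeierstrassCurve.map_c₄, GoldfeldGoodTwists.int49a1_c₄, eq_intCast, eq_ratCast]; norm_num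
  have h6 : (W.baseChange ℂ).c₆ = (((⟨1, -1, 0, -2, -1⟩ : WeierstrassCurve ℤ)).baseChange ℂ).c₆ := by
    simp only [hW, WeierstrassCurve.baseChange, WeierstrassCurve.map_c₆, cm7Int_c₆, eq_intCast, eq_ratCast]; norm_num
  exact ⟨Ω₀, L, hΩ₀, hmem, hCM, by rw [hL.1, h4], by rw [hL.2, h6]⟩

omit [NumberField K] in
/-- ★ **The model lattice at a principal level**: if `Λ_L = Ω_E·ι(𝒪_K)` and `𝔪 = (μ)` with `μ ≠ 0`, then `Λ_L = (Ω_E/ι μ)·ι(𝔪)` — the bridge's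
`hL : ∀ z, z ∈ L.lattice ↔ ∃ a ∈ 𝔪, z = Ω * ι a` with `Ω := Ω_E / ι(μ)` (de Shalit's `L = Ω𝔣`). [cite: deShalit1987, II §4.2 (6) (p. 57)] -/
theorem modelLattice_spec_of_span_singleton_eq (ι : K →+* ℂ) {L : PeriodPair} {Ω : ℂ}
    (hL : ∀ z : ℂ, z ∈ L.lattice ↔ ∃ a : 𝓞 K, z = Ω * ι (a : K)) {𝔪 : Ideal (𝓞 K)} {μ : 𝓞 K} (hμ : μ ≠ 0)
    (h𝔪 : 𝔪 = Ideal.span {μ}) (z : ℂ) :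
    z ∈ L.lattice ↔ ∃ a ∈ 𝔪, z = Ω / ι (μ : K) * ι (a : K) := by
  have hιμ : ι (μ : K) ≠ 0 := (map_ne_zero ι).mpr (by exact_mod_cast hμ)
  rw [hL, h𝔪]
  constructor
  · rintro ⟨a, rfl⟩
    refine ⟨μ * a, Ideal.mem_span_singleton'.mpr ⟨a, mul_comm a μ⟩, ?_⟩
    push_cast
    rw [map_mul]
    field_simp
  · rintro ⟨b, hb, rfl⟩
    obtain ⟨a, rfl⟩ := Ideal.mem_span_singleton'.mp hb
    refine ⟨a, ?_⟩
    push_cast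
    rw [map_mul]
    field_simp

omit [NumberField K] in
/-- `Ω_E/ι(μ) ≠ 0`. [cite: deShalit1987, II §4.2 (6) (p. 57)] -/
theorem modelLattice_scale_ne_zero (ι : K →+* ℂ) {Ω : ℂ} (hΩ : Ω ≠ 0) {μ : 𝓞 K} (hμ : μ ≠ 0) : Ω / ι (μ : K) ≠ 0 :=
  div_ne_zero hΩ ((map_ne_zero ι).mpr (by exact_mod_cast hμ))

end Summit.BirchSwinnertonDyer.BirchSwinnertonDyer.Theorems.PrintCf2.KatzMeasureJZeroSeam

end
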